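import Mathlib

/-!
# The balanced pair identity and the metric depth bound (all product-ranks)
(supports `stub_swallowedInSmallSumset`, crux `MomentCurveElusive`, item stmt-ValiantsHypothesis-6534,
route GirthSidon, line `registered`; companion of `GirthSidonMomentCurveElusiveDepthMatroid.lean`)

Setting as in the companion file: unit sources `u_j ∈ K⟦X⟧`, targets `Σ_P c_P u_a u_b = κ X^γ` summed over
pairs `P = (a, b)` of one weight, source-incidence vector `ε = Σ_P c_P (e_a + e_b)`.  The circuit law of the
companion file ("on a dependency of incidence vectors the minimal depth is attained twice") is proved there
for 2×2 gadgets and is FALSE once product-rank-3 targets take part (explicit `n = 7` swallowing,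
LEAD-ANALYSIS-c4.md §6 in the crux directory).  What survives for every product-rank is recorded here:

* `sum_balancedPairs_eq_shifted` — if `d` is BALANCED (`Σ_P d_P (e_a + e_b) = 0`, e.g. `d = c_{i₀} − Σ q_j c_j`
  for dependent targets) then `Σ_P d_P u_a u_b = Σ_P d_P (u_a − φ)(u_b − φ)` for every `φ`;
* `X_pow_dvd_sum_balancedPairs` — hence if all sources agree with `φ` modulo `X^ν` the balanced combination
  vanishes modulo `X^{2ν}`: a uniquely-minimal depth on a dependency is `≥ 2ν` (sharp: `g = 2`, `ν = 1` in §6).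

Not here: anything matroidal for rank ≥ 3 (false), cascades across weights.
-/

-- (Sub = Summit), so the duplicated namespace component is intended.
set_option linter.dupNamespace false

namespace Summit.ValiantsHypothesis.ValiantsHypothesis.Theorems

open PowerSeries Finset

/-- **Balanced pair identity.** If coefficients `d_i` on pairs `(a_i, b_i)` of indices are BALANCED
(for every index `j`, `∑_i d_i ([a_i = j] + [b_i = j]) = 0`), then for every `φ`
`∑_i d_i u_{a_i} u_{b_i} = ∑_i d_i (u_{a_i} − φ)(u_{b_i} − φ)`: the cross terms vanish by balance and
`∑ d_i = 0` (half the total balance; characteristic zero).  In the crux's setting `d = c_{i₀} − Σ q_j c_j`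
is the difference of the pair-coefficient vectors of targets whose source-incidence vectors are dependent.
[folklore] -/
theorem sum_balancedPairs_eq_shifted {K : Type*} [Field K] [CharZero K] {R : Type*} [CommRing R]
    [Algebra K R] {n m : ℕ} (u : Fin n → R) (a b : Fin m → Fin n) (d : Fin m → K)
    (hbal : ∀ j : Fin n, ∑ i : Fin m, d i *
      ((if a i = j then (1 : K) else 0) + (if b i = j then 1 else 0)) = 0) (φ : R) :
    ∑ i : Fin m, d i • (u (a i) * u (b i)) = ∑ i : Fin m, d i • ((u (a i) - φ) * (u (b i) - φ)) := by
  classical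
  -- total balance: `∑ d_i = 0`
  have hsum : ∑ i : Fin m, d i = 0 := by
    have h2 : ∑ j : Fin n, ∑ i : Fin m, d i *
        ((if a i = j then (1 : K) else 0) + (if b i = j then 1 else 0)) = 0 :=
      Finset.sum_eq_zero fun j _ => hbal j
    rw [Finset.sum_comm] at h2
    have h3 : ∀ i : Fin m, ∑ j : Fin n, d i *
        ((if a i = j then (1 : K) else 0) + (if b i = j then 1 else 0)) = 2 * d i := by
      intro i
      rw [← Finset.mul_sum, Finset.sum_add_distrib, Finset.sum_ite_eq, Finset.sum_ite_eq]
      simp; ring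
    simp_rw [h3, ← Finset.mul_sum] at h2
    simpa using h2
  -- linear balance against any vector `v`: `∑ d_i (v_{a_i} + v_{b_i}) = 0`
  have hlin : ∀ v : Fin n → R, ∑ i : Fin m, d i • (v (a i) + v (b i)) = 0 := by
    intro v
    have key : ∀ i : Fin m, v (a i) + v (b i) =
        ∑ j : Fin n, ((if a i = j then (1 : K) else 0) + (if b i = j then 1 else 0)) • v j := by
      intro i
      rw [Finset.sum_congr rfl fun j _ => add_smul _ _ (v j), Finset.sum_add_distrib]
      simp [ite_smul, Finset.sum_ite_eq]
    simp_rw [key, Finset.smul_sum, smul_smul]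
    rw [Finset.sum_comm]
    refine Finset.sum_eq_zero fun j _ => ?_
    rw [← Finset.sum_smul, hbal j, zero_smul]
  -- expand the right-hand side
  have hexp : ∀ i : Fin m, d i • ((u (a i) - φ) * (u (b i) - φ)) =
      d i • (u (a i) * u (b i)) - φ * (d i • (u (a i) + u (b i))) + (d i • (φ * φ)) := by
    intro i
    rw [show (u (a i) - φ) * (u (b i) - φ) = u (a i) * u (b i) - φ * (u (a i) + u (b i)) + φ * φ by ring,
      smul_add, smul_sub, mul_smul_comm]
  simp_rw [hexp, Finset.sum_add_distrib, Finset.sum_sub_distrib, ← Finset.mul_sum, hlin u, mul_zero,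
    sub_zero, ← Finset.sum_smul, hsum, zero_smul, add_zero]

/-- **Metric depth bound (all product-ranks).** With balanced coefficients as above, if every source
`u_j` is congruent to a common `φ` modulo `X^ν` (the units cluster within radius `ν`), then the balanced
combination `∑ d_i u_{a_i} u_{b_i}` vanishes modulo `X^{2ν}`.  Applied to `d = c_{i₀} − Σ q_j c_j` this says:
on a dependency of source-incidence vectors whose minimal depth `g` is attained only once, `g ≥ 2ν` —
sharp by the §6 example (`g = 2`, `ν = 1`). [folklore] -/
theorem X_pow_dvd_sum_balancedPairs {K : Type*} [Field K] [CharZero K] {n m : ℕ}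
    (u : Fin n → K⟦X⟧) (a b : Fin m → Fin n) (d : Fin m → K)
    (hbal : ∀ j : Fin n, ∑ i : Fin m, d i *
      ((if a i = j then (1 : K) else 0) + (if b i = j then 1 else 0)) = 0)
    (φ : K⟦X⟧) (ν : ℕ) (hν : ∀ j, (X : K⟦X⟧) ^ ν ∣ u j - φ) :
    (X : K⟦X⟧) ^ (2 * ν) ∣ ∑ i : Fin m, d i • (u (a i) * u (b i)) := by
  rw [sum_balancedPairs_eq_shifted u a b d hbal φ]
  refine Finset.dvd_sum fun i _ => ?_
  obtain ⟨p, hp⟩ := hν (a i)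
  obtain ⟨q, hq⟩ := hν (b i)
  rw [Algebra.smul_def, hp, hq, two_mul, pow_add]
  exact Dvd.dvd.mul_left ⟨p * q, by ring⟩ _

/-- **Registered helper stub `helper_balancedPairMetricBound`** (crux stmt-ValiantsHypothesis-6534, line
`registered`): `X_pow_dvd_sum_balancedPairs` over `ℂ`, all binders spelled out. [folklore] -/
theorem helper_balancedPairMetricBound : ∀ (n m ν : ℕ) (u : Fin n → PowerSeries ℂ) (a b : Fin m → Fin n) (d : Fin m → ℂ) (φ : PowerSeries ℂ), (∀ j : Fin n, ∑ i : Fin m, d i * ((if a i = j then (1 : ℂ) else 0) + (if b i = j then 1 else 0)) = 0) → (∀ j, (PowerSeries.X : PowerSeries ℂ) ^ ν ∣ u j - φ) → (PowerSeries.X : PowerSeries ℂ) ^ (2 * ν) ∣ ∑ i : Fin m, d i • (u (a i) * u (b i)) :=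
  fun _ _ ν u a b d φ hbal hν => X_pow_dvd_sum_balancedPairs u a b d hbal φ ν hν

end Summit.ValiantsHypothesis.ValiantsHypothesis.Theorems
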